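import Mathlib.Algebra.MvPolynomial.Degrees
import Literature.Computability.AlgebraicComplexity.ArithCircuit
import Literature.Computability.AlgebraicComplexity.ArithCircuitProofs
import Literature.Computability.AlgebraicComplexity.ConstantFreeCircuits
import Literature.Computability.AlgebraicComplexity.ValiantClasses
import HarnessLib

/-!
# The constant-free Valiant classes `VP⁰` and `VNP⁰` (Malod 2003; Koiran 2004; Bürgisser 2009)

Definitions (with bodies) of the notions of Bürgisser, *On defining integers and proving
arithmetic circuit lower bounds* (Comput. Complexity 18 (2009); ECCC TR06-113, §2.2 —
numbering of the ECCC report is quoted) that the tree lacked: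

* the **formal degree** of a circuit (`ArithCircuit.formalDegree`): input nodes (variables and
  constants) have formal degree `1`, a sum gate the maximum of the formal degrees of its
  operands, a product gate their sum; the formal degree of the circuit is that of its output
  (Bürgisser 2009, §2.2, paragraph before Def. 2.7);
* `IsVP0Family f` — **`VP⁰`** (Bürgisser 2009, Def. 2.7; Malod 2003; Koiran 2004, §1.2): `f` is
  computed by a sequence of fan-in-two, division-free, *constant-free* circuits whose size and
  formal degree are polynomially bounded (and, as for every p-family of the tree, the number of
  variables `#σ n` is polynomially bounded);
* `IsVNP0Family f` — **`VNP⁰`** (Bürgisser 2009, Def. 2.8): `f n = ∑_{e ∈ {0,1}^{u n}} g n (X, e)`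
  for some `g ∈ VP⁰` (`boolSum`, as in `IsVNPFamily`); `u` is automatically p-bounded.

API (all proved): formal degree of the input circuits and under renaming; the degree bound
`ArithCircuit.totalDegree_eval_le_formalDegree` (the value of a circuit has total degree at
most its formal degree), whence `IsVP0Family.isPFamily`; `IsVP0Family.isPBounded_constantFreeComplexity`
("clearly, if `(f_n) ∈ VP⁰` then `τ(f_n) = n^{O(1)}`", Bürgisser 2009 after Def. 2.7);
`IsVP0Family.rename` (injective renamings into p-bounded variable types) and
`IsVP0Family.isVNP0Family` (`VP⁰ ⊆ VNP⁰`, empty Boolean sum).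

These classes carry the two facts of Bürgisser 2009 used in the proof of his Thm. 4.1
(Thm. 2.10: `τ(Per) = n^{O(1)} ⇒ τ(2^{p(n)} f_n) = n^{O(1)}` for `(f_n) ∈ VNP⁰`; Thm. 2.11 =
Koiran 2004, Thm. 6.1), vendored in `BurgisserTransferProofs.lean`.

## Design notes

* Junk gate references (forward/out of range) evaluate to the junk value `0 = const 0`, an input
  node, so they get formal degree `1` (`List.getD _ _ 1`); an empty sum gate (value `0`) gets
  formal degree `0` and an empty product gate (value `1`) gets `0` — edge cases outside
  Bürgisser's fan-in-exactly-two model, immaterial for the classes (polynomial bounds).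
* Coefficients are `ℤ`: constant-free circuits compute integer polynomials (Bürgisser 2009,
  Def. 2.6–2.8 are over `ℤ ⊂ ℚ`).

## References

* P. Bürgisser, *On defining integers and proving arithmetic circuit lower bounds*, Comput.
  Complexity 18 (2009) 81–103 = ECCC TR06-113, §2.2, Def. 2.7, Def. 2.8.
* G. Malod, *Polynômes et coefficients*, PhD thesis, Univ. Lyon 1, 2003.
* P. Koiran, *Valiant's model and the cost of computing integers*, Comput. Complexity 13 (2004)
  131–146, §1.2.
* P. Bürgisser, *Completeness and Reduction in Algebraic Complexity Theory*, Springer 2000,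
  Def. 2.1–2.5 (p-bounded, p-families, `VP`, `VNP`).
-/

noncomputable section

open MvPolynomial

namespace Literature.Computability.AlgebraicComplexity

universe u v w

namespace ArithCircuit

variable {k : Type u} {σ : Type v} {τ : Type w}

/-! ### Formal degree -/

/-- Formal degree of an operand given the formal degrees of the gates computed so far: input
nodes (variables and constants) have formal degree `1`; a gate reference reads the list (junk
references, whose value is the input node `const 0`, get `1`) (Bürgisser 2009, §2.2). [cite: Burgisser2006, §2.2] -/
def Operand.formalDegree (degs : List ℕ) : Operand k σ → ℕ
  | .var _ => 1
  | .const _ => 1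
  | .gate j => degs.getD j 1

/-- Formal degree of a gate: the maximum of the formal degrees of the operands of a sum gate,
the sum of those of a product gate (Bürgisser 2009, §2.2). [cite: Burgisser2006, §2.2] -/
def Gate.formalDegree (degs : List ℕ) : Gate k σ → ℕ
  | .sum args => (args.map fun a => a.2.formalDegree degs).foldr max 0
  | .prod args => (args.map fun u => u.formalDegree degs).sum

/-- The list of formal degrees of a list of gates (same left fold as `gateValues`). [cite: Burgisser2006, §2.2] -/
def gateFormalDegrees (gs : List (Gate k σ)) : List ℕ :=
  gs.foldl (fun degs g => degs ++ [g.formalDegree degs]) []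

/-- The **formal degree of a circuit**: the formal degree of its output node
(Bürgisser 2009, §2.2, paragraph before Def. 2.7). [cite: Burgisser2006, §2.2] -/
def formalDegree (P : ArithCircuit k σ) : ℕ :=
  P.output.formalDegree (gateFormalDegrees P.gates)

/-- One step of the fold defining `gateFormalDegrees`. [cite: Burgisser2006, §2.2] -/
@[simp]
theorem gateFormalDegrees_append_singleton (gs : List (Gate k σ)) (g : Gate k σ) :
    gateFormalDegrees (gs ++ [g]) = gateFormalDegrees gs ++ [g.formalDegree (gateFormalDegrees gs)] := by
  simp [gateFormalDegrees, List.foldl_append]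

/-- One formal degree per gate. [cite: Burgisser2006, §2.2] -/
@[simp]
theorem gateFormalDegrees_length (gs : List (Gate k σ)) : (gateFormalDegrees gs).length = gs.length := by
  induction gs using List.reverseRecOn with
  | nil => rfl
  | append_singleton gs g ih => simp [ih]

/-- Input variables have formal degree `1`. [cite: Burgisser2006, §2.2] -/
@[simp]
theorem formalDegree_ofVar (i : σ) : (ofVar i : ArithCircuit k σ).formalDegree = 1 := rfl

/-- Constants have formal degree `1`. [cite: Burgisser2006, §2.2] -/
@[simp]
theorem formalDegree_ofConst (c : k) : (ofConst c : ArithCircuit k σ).formalDegree = 1 := rfl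

/-- Renaming variables does not change the formal degree of an operand. [folklore] -/
theorem Operand.formalDegree_rename (e : σ → τ) (degs : List ℕ) (u : Operand k σ) :
    (u.rename e).formalDegree degs = u.formalDegree degs := by
  cases u <;> rfl

/-- Renaming variables does not change the formal degree of a gate. [folklore] -/
theorem Gate.formalDegree_rename (e : σ → τ) (degs : List ℕ) (g : Gate k σ) :
    (g.rename e).formalDegree degs = g.formalDegree degs := by
  cases g with
  | sum args =>
    simp only [Gate.rename, Gate.formalDegree, List.map_map]
    congr 1
    simp [Function.comp_def, Operand.formalDegree_rename]
  | prod args =>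
    simp only [Gate.rename, Gate.formalDegree, List.map_map]
    congr 1
    simp [Function.comp_def, Operand.formalDegree_rename]

/-- Renaming variables does not change the formal degrees of a gate list. [folklore] -/
theorem gateFormalDegrees_rename (e : σ → τ) (gs : List (Gate k σ)) :
    gateFormalDegrees (gs.map (Gate.rename e)) = gateFormalDegrees gs := by
  induction gs using List.reverseRecOn with
  | nil => rfl
  | append_singleton gs g ih =>
    rw [List.map_append, List.map_singleton, gateFormalDegrees_append_singleton,
      gateFormalDegrees_append_singleton, ih, Gate.formalDegree_rename]

/-- Renaming variables does not change the formal degree of a circuit. [folklore] -/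
@[simp]
theorem formalDegree_rename (e : σ → τ) (P : ArithCircuit k σ) :
    (P.rename e).formalDegree = P.formalDegree := by
  simp [formalDegree, ArithCircuit.rename, gateFormalDegrees_rename, Operand.formalDegree_rename]

/-! ### The value of a circuit has total degree at most its formal degree -/

section DegreeBound

variable [CommSemiring k]

/-- If every value in `vals` has total degree at most the corresponding formal degree in `degs`
(and the lists have equal length), the value of an operand has total degree at most its formal
degree. [cite: Burgisser2006, §2.2] -/
theorem Operand.totalDegree_eval_le (vals : List (MvPolynomial σ k)) (degs : List ℕ)
    (hlen : vals.length = degs.length)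
    (h : ∀ j (hj : j < vals.length), (vals[j]).totalDegree ≤ degs[j]'(hlen ▸ hj)) (u : Operand k σ) :
    (u.eval vals).totalDegree ≤ u.formalDegree degs := by
  cases u with
  | var i =>
    simp only [Operand.eval, Operand.formalDegree]
    calc (X i : MvPolynomial σ k).totalDegree ≤ (Finsupp.single i 1).sum fun _ => id :=
          totalDegree_monomial_le _ _
      _ ≤ 1 := by simp
  | const c => simp [Operand.eval, Operand.formalDegree]
  | gate j =>
    simp only [Operand.eval, Operand.formalDegree, List.getD_eq_getElem?_getD]
    by_cases hj : j < vals.length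
    · rw [List.getElem?_eq_getElem hj, List.getElem?_eq_getElem (hlen ▸ hj)]
      simpa using h j hj
    · rw [List.getElem?_eq_none (by omega), List.getElem?_eq_none (by omega)]
      simp

/-- Under the same hypothesis, the value of a gate has total degree at most its formal degree
(`deg (∑ cᵢ uᵢ) ≤ max deg uᵢ`, `deg (∏ uᵢ) ≤ ∑ deg uᵢ`). [cite: Burgisser2006, §2.2] -/
theorem Gate.totalDegree_eval_le (vals : List (MvPolynomial σ k)) (degs : List ℕ)
    (hlen : vals.length = degs.length)
    (h : ∀ j (hj : j < vals.length), (vals[j]).totalDegree ≤ degs[j]'(hlen ▸ hj)) (g : Gate k σ) :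
    (g.eval vals).totalDegree ≤ g.formalDegree degs := by
  cases g with
  | sum args =>
    simp only [Gate.eval, Gate.formalDegree]
    induction args with
    | nil => simp
    | cons a rest ih =>
      simp only [List.map_cons, List.sum_cons, List.foldr_cons]
      calc (a.1 • a.2.eval vals + (rest.map fun a : k × Operand k σ => a.1 • a.2.eval vals).sum).totalDegree
          ≤ max (a.1 • a.2.eval vals).totalDegree
              ((rest.map fun a : k × Operand k σ => a.1 • a.2.eval vals).sum).totalDegree := totalDegree_add _ _
        _ ≤ max (a.2.formalDegree degs) ((rest.map fun a : k × Operand k σ => a.2.formalDegree degs).foldr max 0) :=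
            max_le_max ((totalDegree_smul_le _ _).trans
              (Operand.totalDegree_eval_le vals degs hlen h a.2)) ih
  | prod args =>
    simp only [Gate.eval, Gate.formalDegree]
    induction args with
    | nil => simp
    | cons u rest ih =>
      simp only [List.map_cons, List.prod_cons, List.sum_cons]
      calc (u.eval vals * (rest.map fun u : Operand k σ => u.eval vals).prod).totalDegree
          ≤ (u.eval vals).totalDegree + ((rest.map fun u : Operand k σ => u.eval vals).prod).totalDegree :=
            totalDegree_mul _ _
        _ ≤ u.formalDegree degs + (rest.map fun u : Operand k σ => u.formalDegree degs).sum :=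
            Nat.add_le_add (Operand.totalDegree_eval_le vals degs hlen h u) ih

/-- Every gate value has total degree at most the corresponding formal degree (induction along
the fold). [cite: Burgisser2006, §2.2] -/
theorem totalDegree_gateValues_le (gs : List (Gate k σ)) :
    ∀ j (hj : j < (gateValues gs).length),
      ((gateValues gs)[j]).totalDegree ≤
        (gateFormalDegrees gs)[j]'(by simpa using hj) := by
  induction gs using List.reverseRecOn with
  | nil => intro j hj; simp at hj
  | append_singleton gs g ih =>
    intro j hj
    have hlen : (gateValues gs).length = (gateFormalDegrees gs).length := by simp
    simp only [gateValues_append_singleton, gateFormalDegrees_append_singleton]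
    rw [gateValues_append_singleton, List.length_append, List.length_singleton] at hj
    by_cases hj' : j < (gateValues gs).length
    · rw [List.getElem_append_left hj', List.getElem_append_left (hlen ▸ hj')]
      exact ih j hj'
    · have hjeq : j = (gateValues gs).length := by omega
      subst hjeq
      rw [List.getElem_append_right (le_refl _)]
      rw [List.getElem_append_right (by simp)]
      simp only [Nat.sub_self, List.getElem_cons_zero, gateValues_length, gateFormalDegrees_length]
      exact Gate.totalDegree_eval_le _ _ hlen ih g

/-- **The value of a circuit has total degree at most its formal degree** (Bürgisser 2009,
§2.2: the formal degree "controls the degree"). [cite: Burgisser2006, §2.2] -/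
theorem totalDegree_eval_le_formalDegree (P : ArithCircuit k σ) :
    P.eval.totalDegree ≤ P.formalDegree :=
  Operand.totalDegree_eval_le _ _ (by simp) (totalDegree_gateValues_le P.gates) P.output

end DegreeBound

end ArithCircuit

/-! ### The classes `VP⁰` and `VNP⁰` -/

section Classes

variable {σ : ℕ → Type v} {τ : ℕ → Type w} [∀ n, Fintype (σ n)] [∀ n, Fintype (τ n)]

/-- **`VP⁰`** (Bürgisser 2009, Def. 2.7; Malod 2003; Koiran 2004): the family `f = (f_n)` of
integer polynomials is computed by a sequence `(C_n)` of fan-in-two, division-free and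
constant-free (`HasSignConstants`: constants and sum coefficients in `{0, 1, -1}`) arithmetic
circuits such that the size and the formal degree of `C_n` are polynomially bounded in `n`; as for
all p-families (Bürgisser 2000, Def. 2.3) the number `#σ n` of variables is polynomially bounded. [cite: Burgisser2006, Def. 2.7] -/
def IsVP0Family (f : ∀ n, MvPolynomial (σ n) ℤ) : Prop :=
  IsPBounded (fun n => Fintype.card (σ n)) ∧
    ∃ C : ∀ n, ArithCircuit ℤ (σ n),
      (∀ n, (C n).IsFanInTwo ∧ (C n).HasSignConstants ∧ (C n).Computes (f n)) ∧
        IsPBounded (fun n => (C n).size) ∧ IsPBounded fun n => (C n).formalDegree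

/-- **`VNP⁰`** (Bürgisser 2009, Def. 2.8; Malod 2003; Koiran 2004): there is a family
`g = (g_n) ∈ VP⁰` in the variables `σ n ⊕ Fin (u n)` with
`f_n(X) = ∑_{e ∈ {0,1}^{u n}} g_n(X, e)` (`boolSum`). The length `u n` of the Boolean sum is
polynomially bounded automatically (`#(σ n ⊕ Fin (u n))` is, `g` being in `VP⁰`). [cite: Burgisser2006, Def. 2.8] -/
def IsVNP0Family (f : ∀ n, MvPolynomial (σ n) ℤ) : Prop :=
  ∃ (u : ℕ → ℕ) (g : ∀ n, MvPolynomial (σ n ⊕ Fin (u n)) ℤ),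
    IsVP0Family g ∧ ∀ n, f n = boolSum (g n)

/-- "Clearly, if `(f_n) ∈ VP⁰` then `τ(f_n) = n^{O(1)}`" (Bürgisser 2009, after Def. 2.7):
the circuits witnessing `VP⁰` bound `τ`. [cite: Burgisser2006, Def. 2.7] -/
theorem IsVP0Family.isPBounded_constantFreeComplexity {f : ∀ n, MvPolynomial (σ n) ℤ}
    (hf : IsVP0Family f) : IsPBounded fun n => constantFreeComplexity (f n) := by
  obtain ⟨-, C, hC, hsize, -⟩ := hf
  exact hsize.mono fun n =>
    ArithCircuit.constantFreeComplexity_le_size (hC n).1 (hC n).2.1 (hC n).2.2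

/-- A `VP⁰` family is a p-family: its number of variables and its degree are polynomially
bounded (degree at most the formal degree, `totalDegree_eval_le_formalDegree`)
(Bürgisser 2009, after Def. 2.7; Bürgisser 2000, Def. 2.3). [cite: Burgisser2006, Def. 2.7] -/
theorem IsVP0Family.isPFamily {f : ∀ n, MvPolynomial (σ n) ℤ} (hf : IsVP0Family f) :
    IsPFamily f := by
  obtain ⟨hcard, C, hC, -, hdeg⟩ := hf
  refine ⟨hcard, hdeg.mono fun n => ?_⟩
  have h := ArithCircuit.totalDegree_eval_le_formalDegree (C n)
  have he : (C n).eval = f n := (hC n).2.2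
  rwa [he] at h

/-- The length of the Boolean sum of a `VNP⁰` family is polynomially bounded (Bürgisser 2009,
Def. 2.8: "`u(n)` and `v(n)` are polynomially bounded functions of `n`"). [cite: Burgisser2006, Def. 2.8] -/
theorem IsVNP0Family.exists_isPBounded {f : ∀ n, MvPolynomial (σ n) ℤ} (hf : IsVNP0Family f) :
    ∃ (u : ℕ → ℕ) (g : ∀ n, MvPolynomial (σ n ⊕ Fin (u n)) ℤ),
      IsPBounded u ∧ IsVP0Family g ∧ ∀ n, f n = boolSum (g n) := by
  obtain ⟨u, g, hg, hfg⟩ := hf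
  refine ⟨u, g, hg.1.mono fun n => ?_, hg, hfg⟩
  simp [Fintype.card_sum]

/-- `VP⁰` is stable under injective renamings into p-bounded variable types (rename the
circuits: size, sign constants and formal degree are unchanged). [cite: Burgisser2006, Def. 2.7] -/
theorem IsVP0Family.rename {f : ∀ n, MvPolynomial (σ n) ℤ} (hf : IsVP0Family f)
    (e : ∀ n, σ n → τ n) (hτ : IsPBounded fun n => Fintype.card (τ n)) :
    IsVP0Family fun n => MvPolynomial.rename (e n) (f n) := by
  obtain ⟨-, C, hC, hsize, hdeg⟩ := hf
  refine ⟨hτ, fun n => (C n).rename (e n), fun n => ⟨(hC n).1.rename _, (hC n).2.1.rename _,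
    (hC n).2.2.rename _⟩, ?_, ?_⟩
  · simpa using hsize
  · simpa using hdeg

/-- **`VP⁰ ⊆ VNP⁰`** (empty Boolean sum, `u = 0`; Bürgisser 2009, §2.2). [cite: Burgisser2006, Def. 2.8] -/
theorem IsVP0Family.isVNP0Family {f : ∀ n, MvPolynomial (σ n) ℤ} (hf : IsVP0Family f) :
    IsVNP0Family f := by
  refine ⟨fun _ => 0, fun n => MvPolynomial.rename Sum.inl (f n), hf.rename _ ?_, fun n => ?_⟩
  · exact hf.1.mono fun n => by simp [Fintype.card_sum]
  · -- the Boolean sum over `Fin 0 → Bool` has the single term `e = elim0`, and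
    -- `aeval (Sum.elim X _) (rename inl f) = aeval X f = f`
    simp only [boolSum]
    rw [Fintype.sum_unique]
    rw [MvPolynomial.aeval_rename]
    simp [Function.comp_def, MvPolynomial.aeval_X_left]

end Classes

end Literature.Computability.AlgebraicComplexity
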